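import Summits.QuantumFields.GaugeBoot.BootstrapSiteCutsAllAxes
import HarnessLib

/-!
# The full torus constraint system: all lattice symmetries and the site and link cuts along EVERY
# axis — sound and convergent for `β ≥ 0`, infeasible at `β < 0` for `SU(2n+1)` (gauge-boot, L3 ↔ L1)

HONEST FRAMING (cell `pub-gaugeboot`, page 1 of every file): the venture produces certified bounds
on lattice expectations at stated coupling, gauge group, dimension and torus size; NOT a mass gap,
NOT a continuum limit, NOT a string tension; NOT Yang–Mills-summit-bearing (barriers
`FixedCouplingUltralocality`, `PerturbativeInvisibility`). Structural; it certifies no number; no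
certificate of the cell sits at `β < 0`. It says which constraints a TORUS bootstrap may impose.

## Content

`BootstrapAllCuts` assembled the standard constraint system of a lattice Yang–Mills bootstrap on the
torus (moment positivity, loop equations, invariance under translations / axis permutations / the
reflection / charge conjugation / centre twists, the site-RP and link-RP cuts ALONG THE TIME AXIS) and
proved it sound and convergent (`β ≥ 0`, even `L`). A practical bootstrap (Kazakov–Zheng §4) uses
the reflections along EVERY axis. On the even torus `(ℤ/2Q)^d`, `Q ≥ 2`, this module adds the site
cuts `Θ'_k` and the link cuts `Θ_k` of ALL axes `k` (`BootstrapSiteCutsAllAxes`,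
`BootstrapLinkCutsAllAxes`) — the diagonal family is excluded on purpose (inconsistent in `d ≥ 3`,
`BootstrapDiagonalReflectionPositivity`):

* `allAxesCutsLevelValuesSuN N β n P` — the level-`n` feasible values of `P` in the FULL system;
  `allAxesCutsLevelValues_subset_allCuts` — it refines `allCutsLevelValuesSuN` (the time-axis cuts
  are the instance `k = 0`), `…_subset_siteCut`, `…_subset_linkCut`, `…_subset_levelValues`;
* ★★★ `wilson_mem_allAxesCutsLevelValues_suN` — `β ≥ 0`, every `N`: the Wilson value is feasible at
  every level; ★★★ `wilson_mem_allAxesCutsLevelValues_suEven` — `SU(2n)`: at EVERY real `β`;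
  ★★★ `allAxesCutsLevelValues_subset_Icc_suN` — the bounds converge to the Wilson value;
  ★★★ `allAxesCuts_sound_and_convergent_suN` — summary (`β ≥ 0`);
* ★★★ `allAxesCuts_sound_iff_suOdd` — `N` odd, `3 ≤ N`, `N + 3 ≤ 2d`: the full system keeps the
  Wilson value feasible at every level for every observable IFF `0 ≤ β`;
  ★★★ `allAxesCutsLevelValues_eventually_eq_empty_suOdd` — at every `β < 0` it is INFEASIBLE at all
  large levels for every objective (the link cuts of any single axis already are);
  `SU(3)`, `d ≥ 3`: `allAxesCuts_sound_iff_su3`, `allAxesCutsLevelValues_eventually_eq_empty_su3`.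

What this is NOT: odd tori; the diagonal family; rates; `SU(2n+1)` with `2d < N + 3` at `β < 0`.

References: V. Kazakov, Z. Zheng, arXiv:2203.11360 §3–§4; P. D. Anderson, M. Kruczenski, Nucl.
Phys. B 921 (2017) 702; K. Osterwalder, E. Seiler, Ann. Phys. 110 (1978) 440 §2. Folklore-level.
-/

noncomputable section

open MeasureTheory Filter Topology NormedSpace
open scoped ComplexOrder
open Literature.MathematicalPhysics.QuantumFieldTheory (LatticeRep Site Edge GaugeConfig wilsonAction wilsonMeasure
  isProbabilityMeasure_wilsonMeasure)
open Literature.MathematicalPhysics.QuantumFieldTheory.WilsonSiteRP (sitePosEdges sharedEdges)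

namespace Summit.QuantumFields.GaugeBoot

open Literature.MathematicalPhysics.QuantumLattice

variable {d Q : ℕ} [NeZero d] [NeZero Q] (N : ℕ) (β : ℝ)

/-- **The level-`n` feasible values of `P` in the FULL torus constraint system** on `(ℤ/2Q)^d`:
word-level-`n` `SU(N)` bootstrap feasibility (normalisation, moment positivity, loop equations),
invariance under `allSymmetries` on the level-`n` test functions, and the SITE cuts `Θ'_k` and LINK
cuts `Θ_k` along EVERY axis `k` on the level-`n` test functions of the respective closed halves.
[folklore] -/
def allAxesCutsLevelValuesSuN (n : ℕ) (P : C(GaugeConfig d (2 * Q) (Matrix.specialUnitaryGroup (Fin N) ℂ), ℝ)) :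
    Set ℝ :=
  {t | ∃ φ : C(GaugeConfig d (2 * Q) (Matrix.specialUnitaryGroup (Fin N) ℂ), ℝ) →ₗ[ℝ] ℝ,
    IsBootstrapFeasible (fundamentalLatticeRep N) (suExp N)
        (fun _ => wilsonAction (fundamentalRep (Fin N))) β
        (wordTruncation (ι := Edge d (2 * Q)) (fundamentalLatticeRep N) n) φ ∧
      (∀ R ∈ allSymmetries (d := d) (L := 2 * Q) N,
        ∀ v ∈ wordTruncation (ι := Edge d (2 * Q)) (fundamentalLatticeRep N) n, φ (v.comp R) = φ v) ∧
      (∀ (k : Fin d), ∀ v ∈ wordTruncation (ι := Edge d (2 * Q)) (fundamentalLatticeRep N) n,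
        DependsOn (⇑v) (halfLinks (d := d) Q k) → 0 ≤ φ (v.comp (siteReflectCM k) * v)) ∧
      (∀ (k : Fin d), ∀ v ∈ wordTruncation (ι := Edge d (2 * Q)) (fundamentalLatticeRep N) n,
        DependsOn (⇑v) (midHalfLinks (d := d) Q k) → 0 ≤ φ (v.comp (midReflectCM k) * v)) ∧
      φ P = t}

/-- The full system refines the plain word truncation. -/
theorem allAxesCutsLevelValues_subset_levelValues (n : ℕ)
    (P : C(GaugeConfig d (2 * Q) (Matrix.specialUnitaryGroup (Fin N) ℂ), ℝ)) :
    allAxesCutsLevelValuesSuN (d := d) (Q := Q) N β n P ⊆ levelValuesSuN (d := d) (L := 2 * Q) N β n P := by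
  rintro t ⟨φ, hφ, -, -, -, rfl⟩
  exact ⟨φ, hφ, rfl⟩

/-- The full system refines the site cut family of every axis. -/
theorem allAxesCutsLevelValues_subset_siteCut (k : Fin d) (n : ℕ)
    (P : C(GaugeConfig d (2 * Q) (Matrix.specialUnitaryGroup (Fin N) ℂ), ℝ)) :
    allAxesCutsLevelValuesSuN (d := d) (Q := Q) N β n P ⊆ siteCutLevelValuesSuN N β k n P := by
  rintro t ⟨φ, hφ, -, hsite, -, rfl⟩
  exact ⟨φ, hφ, fun v hv hvS => hsite k v hv hvS, rfl⟩

/-- The full system refines the link cut family of every axis. -/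
theorem allAxesCutsLevelValues_subset_linkCut (k : Fin d) (n : ℕ)
    (P : C(GaugeConfig d (2 * Q) (Matrix.specialUnitaryGroup (Fin N) ℂ), ℝ)) :
    allAxesCutsLevelValuesSuN (d := d) (Q := Q) N β n P ⊆ linkCutLevelValuesSuN N β k n P := by
  rintro t ⟨φ, hφ, -, -, hlink, rfl⟩
  exact ⟨φ, hφ, fun v hv hvS => hlink k v hv hvS, rfl⟩

/-- **The full system refines `allCutsLevelValuesSuN` of `BootstrapAllCuts`** (`Q ≥ 2`): the time-axis
site and link cuts there are the instance `k = 0` (`halfLinks_zero_dependsOn_iff`,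
`isPositiveTimeObservable_iff_isMidObservable`, `midReflectCM_zero_eq_timeReflectCM`). -/
theorem allAxesCutsLevelValues_subset_allCuts (hQ : 2 ≤ Q) (n : ℕ)
    (P : C(GaugeConfig d (2 * Q) (Matrix.specialUnitaryGroup (Fin N) ℂ), ℝ)) :
    allAxesCutsLevelValuesSuN (d := d) (Q := Q) N β n P ⊆ allCutsLevelValuesSuN (d := d) (L := 2 * Q) N β n P := by
  rintro t ⟨φ, hφ, hsym, hsite, hlink, rfl⟩
  refine ⟨φ, hφ, hsym, fun v hv hdep => ?_, fun v hv hvt => ?_, rfl⟩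
  · have h := hsite 0 v hv ((halfLinks_zero_dependsOn_iff hQ (⇑v)).2 hdep)
    rwa [siteReflectCM_zero_eq_negReflectCM] at h
  · have h := hlink 0 v hv ((isMidObservable_iff_dependsOn Q 0 (⇑v)).1
      ((isPositiveTimeObservable_iff_isMidObservable (⇑v)).1 hvt))
    rwa [midReflectCM_zero_eq_timeReflectCM] at h

/-! ## Sound and convergent: `β ≥ 0` (every `N`); every `β` for `SU(2n)` -/

/-- ★★★ **`β ≥ 0`, every `N`, `(ℤ/2Q)^d`, `Q ≥ 2`: the Wilson value is feasible in the FULL system at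
every level** (symmetries: `allSymmetries_preserve_wilson_suN`; site cuts of every axis at every `β`:
`reflectionPositiveOn_siteReflect_suN`; link cuts of every axis at `β ≥ 0`: `cubicTorus_linkRP_suN`).
[folklore] -/
theorem wilson_mem_allAxesCutsLevelValues_suN (hQ : 2 ≤ Q) (hβ : 0 ≤ β) (n : ℕ)
    (P : C(GaugeConfig d (2 * Q) (Matrix.specialUnitaryGroup (Fin N) ℂ), ℝ)) :
    ∫ U, P U ∂(wilsonMeasure (fundamentalRep (Fin N)) β) ∈ allAxesCutsLevelValuesSuN (d := d) (Q := Q) N β n P := by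
  haveI : IsProbabilityMeasure (wilsonMeasure (d := d) (L := 2 * Q) (fundamentalRep (Fin N)) β) :=
    isProbabilityMeasure_wilsonMeasure (ρ := fundamentalRep (Fin N)) (continuous_fundamentalRep _) β
  refine ⟨expectationFunctional (wilsonMeasure (fundamentalRep (Fin N)) β),
    isBootstrapFeasible_wilson_suN N β _ rfl (wordTruncation_subset_polyAlgebra _ n), fun R hR v _ => ?_,
    fun k v _ hvS => ?_, fun k v _ hvS => ?_, rfl⟩
  · rw [expectationFunctional_apply, expectationFunctional_apply]
    exact allSymmetries_preserve_wilson_suN N β R hR v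
  · rw [expectationFunctional_apply]
    have h := (reflectionPositiveOn_siteReflect_suN N β hQ k).real v hvS
    simpa only [ContinuousMap.mul_apply, ContinuousMap.comp_apply] using h
  · rw [expectationFunctional_apply]
    have h := ((reflectionPositiveOn_midReflect_iff (fundamentalRep (Fin N)) β k).2
      (TiltedRP.cubicTorus_linkRP_suN hQ k hβ)).real v hvS
    simpa only [ContinuousMap.mul_apply, ContinuousMap.comp_apply] using h

/-- ★★★ **`SU(M)`, `M` even: the Wilson value is feasible in the FULL system at every level, at EVERY
real `β`** (link cuts of every axis at every `β`: `cubicTorus_linkRP_suEven_anyBeta`). [folklore] -/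
theorem wilson_mem_allAxesCutsLevelValues_suEven {M : ℕ} (hM : Even M) (hQ : 2 ≤ Q) (n : ℕ)
    (P : C(GaugeConfig d (2 * Q) (Matrix.specialUnitaryGroup (Fin M) ℂ), ℝ)) :
    ∫ U, P U ∂(wilsonMeasure (fundamentalRep (Fin M)) β) ∈ allAxesCutsLevelValuesSuN (d := d) (Q := Q) M β n P := by
  haveI : IsProbabilityMeasure (wilsonMeasure (d := d) (L := 2 * Q) (fundamentalRep (Fin M)) β) :=
    isProbabilityMeasure_wilsonMeasure (ρ := fundamentalRep (Fin M)) (continuous_fundamentalRep _) β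
  refine ⟨expectationFunctional (wilsonMeasure (fundamentalRep (Fin M)) β),
    isBootstrapFeasible_wilson_suN M β _ rfl (wordTruncation_subset_polyAlgebra _ n), fun R hR v _ => ?_,
    fun k v _ hvS => ?_, fun k v _ hvS => ?_, rfl⟩
  · rw [expectationFunctional_apply, expectationFunctional_apply]
    exact allSymmetries_preserve_wilson_suN M β R hR v
  · rw [expectationFunctional_apply]
    have h := (reflectionPositiveOn_siteReflect_suN M β hQ k).real v hvS
    simpa only [ContinuousMap.mul_apply, ContinuousMap.comp_apply] using h
  · rw [expectationFunctional_apply]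
    have h := ((reflectionPositiveOn_midReflect_iff (fundamentalRep (Fin M)) β k).2
      (TiltedRP.cubicTorus_linkRP_suEven_anyBeta hM hQ k β)).real v hvS
    simpa only [ContinuousMap.mul_apply, ContinuousMap.comp_apply] using h

/-- ★★★ **The bounds of the FULL system converge to the Wilson value** (every real `β`). [folklore] -/
theorem allAxesCutsLevelValues_subset_Icc_suN {P : C(GaugeConfig d (2 * Q) (Matrix.specialUnitaryGroup (Fin N) ℂ), ℝ)}
    (hP : P ∈ polyAlgebra (ι := Edge d (2 * Q)) (fundamentalLatticeRep N)) {ε : ℝ} (hε : 0 < ε) :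
    ∀ᶠ n in atTop, allAxesCutsLevelValuesSuN (d := d) (Q := Q) N β n P ⊆
      Set.Icc (∫ U, P U ∂(wilsonMeasure (fundamentalRep (Fin N)) β) - ε)
        (∫ U, P U ∂(wilsonMeasure (fundamentalRep (Fin N)) β) + ε) := by
  filter_upwards [levelValues_subset_Icc_suN N β hP hε] with n hn
  exact (allAxesCutsLevelValues_subset_levelValues N β n P).trans hn

/-- ★★★ **Summary, `β ≥ 0`** (`(ℤ/2Q)^d`, `Q ≥ 2`, every `N`, every polynomial observable `P`, every
`ε > 0`): the full torus constraint system has at every level a NONEMPTY feasible set containing the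
Wilson value, and these sets shrink into `[W - ε, W + ε]`. [folklore] -/
theorem allAxesCuts_sound_and_convergent_suN (hQ : 2 ≤ Q) (hβ : 0 ≤ β)
    {P : C(GaugeConfig d (2 * Q) (Matrix.specialUnitaryGroup (Fin N) ℂ), ℝ)}
    (hP : P ∈ polyAlgebra (ι := Edge d (2 * Q)) (fundamentalLatticeRep N)) {ε : ℝ} (hε : 0 < ε) :
    (∀ n, ∫ U, P U ∂(wilsonMeasure (fundamentalRep (Fin N)) β) ∈ allAxesCutsLevelValuesSuN (d := d) (Q := Q) N β n P) ∧
      ∀ᶠ n in atTop, allAxesCutsLevelValuesSuN (d := d) (Q := Q) N β n P ⊆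
        Set.Icc (∫ U, P U ∂(wilsonMeasure (fundamentalRep (Fin N)) β) - ε)
          (∫ U, P U ∂(wilsonMeasure (fundamentalRep (Fin N)) β) + ε) :=
  ⟨fun n => wilson_mem_allAxesCutsLevelValues_suN N β hQ hβ n P, allAxesCutsLevelValues_subset_Icc_suN N β hP hε⟩

/-! ## `N` odd: the full system is consistent IFF `β ≥ 0` -/

variable {N}

/-- ★★★ **At every `β < 0` the FULL system is INFEASIBLE at all large levels, for every objective**
(`N` odd, `3 ≤ N`, `N + 3 ≤ 2d`; `(ℤ/2Q)^d`, `Q ≥ 2`): the link cuts of a single axis already are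
(`linkCutLevelValues_eventually_eq_empty_suOdd`). [folklore] -/
theorem allAxesCutsLevelValues_eventually_eq_empty_suOdd (hQ : 2 ≤ Q) (hN : Odd N) (h3 : 3 ≤ N)
    (hNd : N + 3 ≤ 2 * d) (hβ : β < 0)
    (P : C(GaugeConfig d (2 * Q) (Matrix.specialUnitaryGroup (Fin N) ℂ), ℝ)) :
    ∀ᶠ n in atTop, allAxesCutsLevelValuesSuN (d := d) (Q := Q) N β n P = ∅ := by
  filter_upwards [linkCutLevelValues_eventually_eq_empty_suOdd β hQ (0 : Fin d) hN h3 hNd hβ P] with n hn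
  exact Set.eq_empty_of_subset_empty (hn ▸ allAxesCutsLevelValues_subset_linkCut N β 0 n P)

/-- ★★★ **THE FULL TORUS CONSTRAINT SYSTEM IS CONSISTENT IFF `β ≥ 0`** for `N` odd, `3 ≤ N`,
`N + 3 ≤ 2d` (`(ℤ/2Q)^d`, `Q ≥ 2`): the Wilson value of every observable is feasible at every level iff
`0 ≤ β`. [folklore] -/
theorem allAxesCuts_sound_iff_suOdd (hQ : 2 ≤ Q) (hN : Odd N) (h3 : 3 ≤ N) (hNd : N + 3 ≤ 2 * d) :
    (∀ (n : ℕ) (P : C(GaugeConfig d (2 * Q) (Matrix.specialUnitaryGroup (Fin N) ℂ), ℝ)),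
        ∫ U, P U ∂(wilsonMeasure (fundamentalRep (Fin N)) β) ∈ allAxesCutsLevelValuesSuN (d := d) (Q := Q) N β n P) ↔
      0 ≤ β := by
  refine ⟨fun h => ?_, fun hβ n P => wilson_mem_allAxesCutsLevelValues_suN N β hQ hβ n P⟩
  by_contra hβ
  obtain ⟨n, hn⟩ :=
    (allAxesCutsLevelValues_eventually_eq_empty_suOdd β hQ hN h3 hNd (not_le.1 hβ) 1).exists
  have hmem := h n 1
  rw [hn] at hmem
  exact hmem

/-- ★★★ **`SU(3)`, `d ≥ 3`: the full torus constraint system is consistent IFF `β ≥ 0`.** [folklore] -/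
theorem allAxesCuts_sound_iff_su3 (hQ : 2 ≤ Q) (hd : 3 ≤ d) :
    (∀ (n : ℕ) (P : C(GaugeConfig d (2 * Q) (Matrix.specialUnitaryGroup (Fin 3) ℂ), ℝ)),
        ∫ U, P U ∂(wilsonMeasure (fundamentalRep (Fin 3)) β) ∈ allAxesCutsLevelValuesSuN (d := d) (Q := Q) 3 β n P) ↔
      0 ≤ β :=
  allAxesCuts_sound_iff_suOdd β hQ (by decide) le_rfl (by omega)

/-- ★★★ **`SU(3)`, `d ≥ 3`, every `β < 0`: the full system is eventually infeasible for every
objective.** [folklore] -/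
theorem allAxesCutsLevelValues_eventually_eq_empty_su3 (hQ : 2 ≤ Q) (hd : 3 ≤ d) (hβ : β < 0)
    (P : C(GaugeConfig d (2 * Q) (Matrix.specialUnitaryGroup (Fin 3) ℂ), ℝ)) :
    ∀ᶠ n in atTop, allAxesCutsLevelValuesSuN (d := d) (Q := Q) 3 β n P = ∅ :=
  allAxesCutsLevelValues_eventually_eq_empty_suOdd β hQ (by decide) le_rfl (by omega) hβ P

/-- ★★ **`SU(2)` versus `SU(3)` at negative coupling** (`d ≥ 3`, `(ℤ/2Q)^d`, `Q ≥ 2`, `β < 0`): the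
full system keeps the `SU(2)` Wilson value feasible at every level while the `SU(3)` system is
eventually infeasible. [folklore] -/
theorem allAxesCuts_su2_sound_su3_infeasible (hQ : 2 ≤ Q) (hd : 3 ≤ d) (hβ : β < 0)
    (P₂ : C(GaugeConfig d (2 * Q) (Matrix.specialUnitaryGroup (Fin 2) ℂ), ℝ))
    (P₃ : C(GaugeConfig d (2 * Q) (Matrix.specialUnitaryGroup (Fin 3) ℂ), ℝ)) :
    (∀ n, ∫ U, P₂ U ∂(wilsonMeasure (fundamentalRep (Fin 2)) β) ∈ allAxesCutsLevelValuesSuN (d := d) (Q := Q) 2 β n P₂) ∧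
      ∀ᶠ n in atTop, allAxesCutsLevelValuesSuN (d := d) (Q := Q) 3 β n P₃ = ∅ :=
  ⟨fun n => wilson_mem_allAxesCutsLevelValues_suEven β even_two hQ n P₂,
    allAxesCutsLevelValues_eventually_eq_empty_su3 β hQ hd hβ P₃⟩

end Summit.QuantumFields.GaugeBoot

end
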